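import Summits.NavierStokesRegularity.FluidComputer.AngularGalerkinLadderBasics

/-!
# The angular Galerkin ladder: radial multipliers commute with the Casimir cut; the Galerkin
# defect is orthogonal to every radially cut-off velocity slice (theorems only)

Cell `ns-blowup`, seat `ns-blowup-lean` (g10). LABEL: KERNEL typing hygiene for the vocabulary of
`FluidComputer/AngularGalerkinLadder.lean` (route `Theses/AngularGalerkinLadder.lean`). WHAT THIS IS
NOT: not Navier–Stokes evidence — kinematic identities; nothing is asserted about blow-up or about
the dynamics of any rung, no profile is constructed, no crux is touched.

## Content

The rotation vector fields `x ↦ e_a × x` are tangent to the spheres `‖x‖ = r`, so a RADIAL scalar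
multiplier `χ(‖x‖²)` is invisible to the generators:

* `angGen_radial_smul`: `J_a (χ(‖·‖²) u) = χ(‖·‖²) J_a u` (differentiable `χ`, `u`);
* `casimir_radial_smul`, `bandDefect_radial_smul`: the same for `𝒞` and every
  `∏_{j ≤ L}(𝒞 − j(j+1))` (smooth `χ`, `u`);
* `IsBandLimited.radial_smul`: **band-limited fields stay band-limited under radial cut-offs** —
  the isotypic projections `Π_L` commute with multiplication by radial functions, stated without
  a projection operator;
* `hasCompactSupport_radial_smul`: a compactly supported radial profile cuts any field down to
  compact support;
* `IsCobandLimited.integral_inner_radial_smul` and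
  **`IsRungSolutionOn.integral_inner_defect_radial_smul`**: for a rung-`L` solution `(u, p, d)`
  and every smooth compactly supported `χ : ℝ → ℝ`,
  `∫ ⟪d(t, x), χ(‖x‖²) u(t, x)⟫ dx = 0` for all `t ∈ S` — the Galerkin defect does NO WORK on
  any radially cut-off velocity slice. This is the typed form (by duality, as the vocabulary
  states the cut) of the mechanism behind the exact energy identity of the ladder `NS_L`: the
  defect `(1 − Π_L)P(u·∇u)` is `L²`-orthogonal to the resolved field; letting `χ ↑ 1` is the
  route's structure lemma, not done here.

References: [cite: BullardGellman1954] (vector spherical harmonics with radial coefficients);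
[cite: Tao2016AveragedNS, Thm. 1.5] (rotation averages as order-zero multipliers).
-/

noncomputable section

namespace Summit.NavierStokesRegularity.FluidComputer

open Set MeasureTheory Filter Topology Function
open scoped ContDiff RealInnerProductSpace
open Literature.Analysis.FluidPDE

namespace AngularLadder

variable {u : EuclideanSpace ℝ (Fin 3) → EuclideanSpace ℝ (Fin 3)} {χ : ℝ → ℝ} {L : ℕ}

/-! ## §1 Radial multipliers commute with the generators -/

/-- The rotation field `v × x` is orthogonal to the position vector: `⟪x, v × x⟫ = 0` (it is
tangent to the sphere through `x`). Private: the same identity is landed elsewhere in the tree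
(`…Theorems.ClassBudgetsRegularise.inner_self_cross'`, a route-specific module not imported here).
[folklore] -/
private theorem inner_self_cross_right (v x : EuclideanSpace ℝ (Fin 3)) :
    ⟪x, cross v x⟫ = 0 := by
  simp only [cross, PiLp.inner_apply, cross_apply, RCLike.inner_apply,
    conj_trivial, Fin.sum_univ_three, Matrix.cons_val_zero, Matrix.cons_val_one,
    Matrix.cons_val_two, Matrix.head_cons, Matrix.tail_cons]
  ring

/-- The derivative of a radial function `x ↦ χ(‖x‖²)` vanishes on the rotation field `v × x`.
[folklore] -/
theorem fderiv_radial_apply_cross (hχ : Differentiable ℝ χ) (v x : EuclideanSpace ℝ (Fin 3)) :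
    fderiv ℝ (fun y : EuclideanSpace ℝ (Fin 3) => χ (‖y‖ ^ 2)) x (cross v x) = 0 := by
  have h : HasFDerivAt (fun y : EuclideanSpace ℝ (Fin 3) => χ (‖y‖ ^ 2))
      (deriv χ (‖x‖ ^ 2) • (2 : ℕ) • innerSL ℝ x) x :=
    ((hχ (‖x‖ ^ 2)).hasDerivAt).comp_hasFDerivAt x (hasStrictFDerivAt_norm_sq x).hasFDerivAt
  rw [h.fderiv]
  simp [inner_self_cross_right]

/-- **Radial multipliers commute with the rotation generators**: for differentiable `χ`, `u`,
`J_a (χ(‖·‖²) u)(x) = χ(‖x‖²) (J_a u)(x)` — the extra term `(∂_{e_a × x} χ(‖x‖²)) u(x)` vanishes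
because `e_a × x` is tangent to spheres. [folklore] -/
theorem angGen_radial_smul (hχ : Differentiable ℝ χ) (hu : Differentiable ℝ u) (a : Fin 3) :
    angGen a (fun x => χ (‖x‖ ^ 2) • u x) = fun x => χ (‖x‖ ^ 2) • angGen a u x := by
  funext x
  have hc : HasFDerivAt (fun y : EuclideanSpace ℝ (Fin 3) => χ (‖y‖ ^ 2))
      (fderiv ℝ (fun y : EuclideanSpace ℝ (Fin 3) => χ (‖y‖ ^ 2)) x) x :=
    (((hχ (‖x‖ ^ 2)).hasDerivAt).comp_hasFDerivAt x
      (hasStrictFDerivAt_norm_sq x).hasFDerivAt).differentiableAt.hasFDerivAt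
  have hprod : HasFDerivAt (fun y : EuclideanSpace ℝ (Fin 3) => χ (‖y‖ ^ 2) • u y)
      (χ (‖x‖ ^ 2) • fderiv ℝ u x +
        (fderiv ℝ (fun y : EuclideanSpace ℝ (Fin 3) => χ (‖y‖ ^ 2)) x).smulRight (u x)) x :=
    hc.smul (hu x).hasFDerivAt
  rw [angGen_eq, angGen_eq]
  simp only [hprod.fderiv, _root_.add_apply, _root_.smul_apply,
    ContinuousLinearMap.smulRight_apply, crossCLM_apply, fderiv_radial_apply_cross hχ,
    zero_smul, add_zero, map_smul, smul_sub]

/-- **Radial multipliers commute with the Casimir** (smooth `χ`, `u`). [folklore] -/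
theorem casimir_radial_smul (hχ : ContDiff ℝ ∞ χ) (hu : ContDiff ℝ ∞ u) :
    casimir (fun x => χ (‖x‖ ^ 2) • u x) = fun x => χ (‖x‖ ^ 2) • casimir u x := by
  funext x
  have hχd : Differentiable ℝ χ := hχ.differentiable (by simp)
  have h1 : ∀ a : Fin 3, angGen a (angGen a fun y => χ (‖y‖ ^ 2) • u y) =
      fun y => χ (‖y‖ ^ 2) • angGen a (angGen a u) y := fun a => by
    rw [angGen_radial_smul hχd (hu.differentiable (by simp)),
      angGen_radial_smul hχd ((contDiff_angGen hu a).differentiable (by simp))]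
  simp only [casimir, h1, ← Finset.smul_sum, smul_neg]

/-- **Radial multipliers commute with every band defect** (smooth `χ`, `u`). [folklore] -/
theorem bandDefect_radial_smul (hχ : ContDiff ℝ ∞ χ) (hu : ContDiff ℝ ∞ u) (L : ℕ) :
    bandDefect L (fun x => χ (‖x‖ ^ 2) • u x) = fun x => χ (‖x‖ ^ 2) • bandDefect L u x := by
  induction L with
  | zero => exact casimir_radial_smul hχ hu
  | succ L ih =>
      funext x
      change casimir (bandDefect L fun y => χ (‖y‖ ^ 2) • u y) x -
          (((L : ℝ) + 1) * ((L : ℝ) + 2)) • bandDefect L (fun y => χ (‖y‖ ^ 2) • u y) x =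
        χ (‖x‖ ^ 2) • (casimir (bandDefect L u) x -
          (((L : ℝ) + 1) * ((L : ℝ) + 2)) • bandDefect L u x)
      rw [ih, casimir_radial_smul hχ (contDiff_bandDefect hu L)]
      simp only [smul_sub, smul_comm (χ (‖x‖ ^ 2))]

/-- A radial multiple of a smooth field is smooth. [folklore] -/
theorem contDiff_radial_smul (hχ : ContDiff ℝ ∞ χ) (hu : ContDiff ℝ ∞ u) :
    ContDiff ℝ ∞ fun x : EuclideanSpace ℝ (Fin 3) => χ (‖x‖ ^ 2) • u x :=
  (hχ.comp (contDiff_norm_sq ℝ)).smul hu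

/-- **Band-limited fields stay band-limited under radial cut-offs**: for `u` band-limited of
degree `≤ L` and smooth `χ : ℝ → ℝ`, `x ↦ χ(‖x‖²) u(x)` is band-limited of degree `≤ L` (the
isotypic projections commute with radial multipliers). [folklore] -/
theorem IsBandLimited.radial_smul (hu : IsBandLimited L u) (hχ : ContDiff ℝ ∞ χ) :
    IsBandLimited L fun x => χ (‖x‖ ^ 2) • u x := by
  refine ⟨contDiff_radial_smul hχ hu.1, fun x => ?_⟩
  rw [bandDefect_radial_smul hχ hu.1]
  simp only [hu.2 x, smul_zero]

/-! ## §2 Compactly supported radial cut-offs; the defect does no work on cut-off slices -/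

/-- A compactly supported radial profile cuts every field down to compact support:
`x ↦ χ(‖x‖²) u(x)` has compact support when `χ` has. [folklore] -/
theorem hasCompactSupport_radial_smul (hχ : HasCompactSupport χ)
    (w : EuclideanSpace ℝ (Fin 3) → EuclideanSpace ℝ (Fin 3)) :
    HasCompactSupport fun x : EuclideanSpace ℝ (Fin 3) => χ (‖x‖ ^ 2) • w x := by
  obtain ⟨R, hR⟩ := (Metric.isBounded_iff_subset_closedBall (0 : ℝ)).1 hχ.isCompact.isBounded
  refine HasCompactSupport.intro (isCompact_closedBall (0 : EuclideanSpace ℝ (Fin 3))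
    (Real.sqrt (max R 0))) fun x hx => ?_
  have hxR : max R 0 < ‖x‖ ^ 2 := by
    rw [Metric.mem_closedBall, dist_zero_right, not_le] at hx
    have h0 : 0 ≤ Real.sqrt (max R 0) := Real.sqrt_nonneg _
    calc max R 0 = Real.sqrt (max R 0) ^ 2 := (Real.sq_sqrt (le_max_right _ _)).symm
      _ < ‖x‖ ^ 2 := by gcongr
  have hnot : ‖x‖ ^ 2 ∉ tsupport χ := fun hmem => by
    have := hR hmem
    rw [Metric.mem_closedBall, dist_zero_right, Real.norm_eq_abs, abs_le] at this
    exact absurd (this.2.trans (le_max_left R 0)) (not_le.2 hxR)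
  rw [image_eq_zero_of_notMem_tsupport hnot, zero_smul]

variable {g : EuclideanSpace ℝ (Fin 3) → EuclideanSpace ℝ (Fin 3)}

/-- **A co-band-limited field is orthogonal to every radially cut-off band-limited field**:
`∫ ⟪g, χ(‖·‖²) u⟫ = 0` for `g` co-band-limited and `u` band-limited of the same degree, `χ`
smooth with compact support. [folklore] -/
theorem IsCobandLimited.integral_inner_radial_smul (hg : IsCobandLimited L g)
    (hu : IsBandLimited L u) (hχ : ContDiff ℝ ∞ χ) (hχc : HasCompactSupport χ) :
    ∫ x, ⟪g x, χ (‖x‖ ^ 2) • u x⟫ = 0 :=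
  hg _ (hu.radial_smul hχ) (hasCompactSupport_radial_smul hχc u)

/-- **The Galerkin defect does no work on radially cut-off velocity slices**: for a rung-`L`
solution `(u, p, d)` on the time set `S` (velocity slices band-limited, defect slices
co-band-limited of degree `L`), every `t ∈ S` and every smooth compactly supported radial
profile `χ`, `∫ ⟪d(t, x), χ(‖x‖²) u(t, x)⟫ dx = 0`. [folklore] -/
theorem IsRungSolutionOn.integral_inner_defect_radial_smul {S : Set ℝ} {ν : ℝ}
    {v : ℝ → EuclideanSpace ℝ (Fin 3) → EuclideanSpace ℝ (Fin 3)}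
    {p : ℝ → EuclideanSpace ℝ (Fin 3) → ℝ}
    {d : ℝ → EuclideanSpace ℝ (Fin 3) → EuclideanSpace ℝ (Fin 3)}
    (h : IsRungSolutionOn S ν L v p d) {t : ℝ} (ht : t ∈ S) (hχ : ContDiff ℝ ∞ χ)
    (hχc : HasCompactSupport χ) :
    ∫ x, ⟪d t x, χ (‖x‖ ^ 2) • v t x⟫ = 0 :=
  (h.2.2 t ht).integral_inner_radial_smul (h.2.1 t ht) hχ hχc

/-- The same orthogonality for the velocity slices of a lower rung `L' ≤ L` against a defect
co-band-limited at the higher level `L` (co-band-limitedness is antitone). [folklore] -/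
theorem IsCobandLimited.integral_inner_radial_smul_of_le {L' : ℕ} (hg : IsCobandLimited L g)
    (hu : IsBandLimited L' u) (hle : L' ≤ L) (hχ : ContDiff ℝ ∞ χ) (hχc : HasCompactSupport χ) :
    ∫ x, ⟪g x, χ (‖x‖ ^ 2) • u x⟫ = 0 :=
  hg.integral_inner_radial_smul (hu.mono hle) hχ hχc

end AngularLadder

end Summit.NavierStokesRegularity.FluidComputer

end
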